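import Summits.NavierStokesRegularity.NavierStokesRegularity.Theorems.ExtremiserTransienceNearExtremalTransienceExtremiserLiouvilleConstantSpeedSlidePalinstrophyFrobenius
import HarnessLib

/-!
# Crux `ExtremiserTransience.NearExtremalTransience` (stmt-NavierStokesRegularity-21883), line `extremiser_liouville`,
# stub K1b — `‖D²v‖² ≤ Σₖ|D∂ₖv|²_F` AND `‖Dv‖⁴ ≤ |Dv|⁴_F` (R6b glue between the operator-norm and Frobenius quantities; record §18)

`--supports stmt-NavierStokesRegularity-21883` (helper).  Author: prover seat `ns-el-k1b` (g9).

The Z′-line (`…SlidePalinstrophyLineCoercive`) is coercive in `Σₖ∫g′|D∂ₖv|²_F`, while the quartic line (`…SlideLayerGradientL4`) and the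
L⁴ interpolation produce `∫g′‖D²v‖²` (operator norm of `iteratedFDeriv ℝ 2 v`) and `∫g′|Dv|⁴_F`.  The two pointwise comparisons needed to
close the loop:
* `sq_norm_iteratedFDeriv_two_le_sum_frobeniusNormSq` : `‖D²v(x)‖² ≤ Σₖ |D(∂ₖv)(x)|²_F`;
* `norm_fderiv_pow_four_le_frobeniusNormSq_sq` : `‖Dv(x)‖⁴ ≤ |Dv(x)|²_F²`.

WHAT THIS IS NOT: K1b is NOT proved; nothing here proves NS regularity. [folklore]
-/

noncomputable section

open Set Filter Topology MeasureTheory Metric Function InnerProductSpace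
open scoped ENNReal NNReal Topology InnerProductSpace RealInnerProductSpace ContDiff
open Literature.Analysis.FluidPDE Literature.Analysis

namespace Summit.NavierStokesRegularity.NavierStokesRegularity.Theorems

-- the problem directory repeats the summit name (`NavierStokesRegularity/NavierStokesRegularity`)
set_option linter.dupNamespace false

namespace ExtremiserLiouville

variable {V : EuclideanSpace ℝ (Fin 3) → EuclideanSpace ℝ (Fin 3)}

/-- **`‖D²v(x)‖² ≤ Σₖ|D(∂ₖv)(x)|²_F`** for `v ∈ C²` (operator norm against an orthonormal basis, then operator norm against Frobenius).
[folklore] -/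
theorem sq_norm_iteratedFDeriv_two_le_sum_frobeniusNormSq (hV : ContDiff ℝ 2 V) (x : EuclideanSpace ℝ (Fin 3)) :
    ‖iteratedFDeriv ℝ 2 V x‖ ^ 2 ≤ ∑ k : Fin 3, frobeniusNormSq (fderiv ℝ (fun z => fderiv ℝ V z (EuclideanSpace.basisFun (Fin 3) ℝ k)) x) := by
  have e1 : ‖iteratedFDeriv ℝ 2 V x‖ = ‖fderiv ℝ (fderiv ℝ V) x‖ := by
    rw [← norm_iteratedFDeriv_zero (𝕜 := ℝ) (f := fderiv ℝ (fderiv ℝ V)), norm_iteratedFDeriv_fderiv, norm_iteratedFDeriv_fderiv]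
  rw [e1]
  refine (sq_opNorm_le_sum_sq_norm_apply (EuclideanSpace.basisFun (Fin 3) ℝ) (fderiv ℝ (fderiv ℝ V) x)).trans (Finset.sum_le_sum fun k _ => ?_)
  rw [← fderiv_fderiv_apply_eq hV x]
  exact sq_opNorm_le_frobeniusNormSq _

/-- **`‖Dv(x)‖⁴ ≤ (|Dv(x)|²_F)²`**. [folklore] -/
theorem norm_fderiv_pow_four_le_frobeniusNormSq_sq (x : EuclideanSpace ℝ (Fin 3)) :
    ‖fderiv ℝ V x‖ ^ 4 ≤ frobeniusNormSq (fderiv ℝ V x) ^ 2 := by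
  have h := sq_opNorm_le_frobeniusNormSq (fderiv ℝ V x)
  have h0 : 0 ≤ ‖fderiv ℝ V x‖ ^ 2 := sq_nonneg _
  calc ‖fderiv ℝ V x‖ ^ 4 = (‖fderiv ℝ V x‖ ^ 2) ^ 2 := by ring
    _ ≤ frobeniusNormSq (fderiv ℝ V x) ^ 2 := pow_le_pow_left₀ h0 h 2

end ExtremiserLiouville

end Summit.NavierStokesRegularity.NavierStokesRegularity.Theorems

end
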